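import Summits.BirchSwinnertonDyer.BirchSwinnertonDyer.Theses.SemiOrdinaryEisensteinDescent
import Summits.BirchSwinnertonDyer.BirchSwinnertonDyer.Theorems.WildThreeRankOneBSDpOfGlobalDivisibilityStepL
import HarnessLib

/-!
# Route `SemiOrdinaryEisensteinDescent` (W-ALL/2@3.O6.r1.surj), crux Ko `WildKolyvaginUpperAtThree`
# (stmt-BirchSwinnertonDyer-20480) REDUCED IN THE KERNEL to ONE displayed divisibility statement J₃ʷ + the
# published structure theorem (Matar–Nekovář 2019 Thm. 0.7/§0.11) + Kolyvagin 1990 — the steward's announced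
# split {J (crux), structure (support by name), glue} made closable (seat `bsd-wall-utd-p3` gen 1;
# `--supports stmt-BirchSwinnertonDyer-20480`; nothing booked, no item closed, BSD is not proved by any of this)

WHAT IS PROVED. `wildKolyvaginUpperAtThree_of_globalDivisibility`: the crux `WildKolyvaginUpperAtThree` BY
NAME (its binders verbatim: `ClassO6 W 3`, `ρ̄_{E,3}` onto, `r_an = 1`, `N = N_E`, `K` imaginary quadratic
Heegner for `N`, `L(E^{d_K},1) ≠ 0`, `ι(P) = heegnerPointComplex Dt H`, `P` of infinite order, `d_K` odd,
`d_K ≠ −3`, `TowerSurjThree W`; conclusion `SchneiderFree.Upper.IndexUpperBoundLeAt W 3 K P (v₃ c)`) follows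
from

* `hKo` — Kolyvagin 1990 (`kolyvagin N W K`, named fact, hypothesis: rank one and `Ш(E/K)` finite);
* `hMN` — Matar–Nekovář 2019 Thm. 0.7 read through §0.11 (named fact
  `MatarNekovar2019.thm07_padicValNat_card_sha_primary_add_le_of_globalDivisibility_of_irreducible`,
  hypothesis): Kolyvagin's structure theorem, upper form in McCallum's currency, `ρ̄` irreducible, NO
  reduction binder at `p`, NO tower;
* `hJ` — **J₃ʷ**, DISPLAYED (the research content of Ko; NOT in print): with EXACTLY Ko's binders, every
  derived Heegner point `P_n` on the frame `(Dt, H.β, ι)` (square-free `n`, Kolyvagin primes of index `≥ s′`)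
  is `3^{s′}`-divisible in `E(K[n])` for every `s′ ≤ ord₃ ∏_ℓ c_ℓ(E) + v₃(c(Dt))` — Jetchev 2008 Conj. 1.3
  «`m_∞ ≥ ord₃(c·∏c_q)`», Σ-form, at the additive prime `3`, point currency `Koly.PDiv`;

through utd-p3 g1's tower-free receptacle `SchneiderFree.Exact.upper_of_globalDivisibility_of_surj`
(p542530). The tower binder of Ko is not used (the mod-`3` image suffices for Matar–Nekovář); `d_K ≠ −4`
comes from `d_K` odd. So Ko = J₃ʷ + print, kernel-certified: a glue item «J → structure-by-name → Ko» is
closed by `exact wildKolyvaginUpperAtThree_of_globalDivisibility hKo hMN hJ` (up to binder order of J).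
CONDITIONAL on `hJ`, `hMN`, `hKo`; Ko, J₃ʷ and BSD stay exactly as open as before.

References: [Jetchev2008] Conj. 1.3, Thm. 1.4, Cor. 1.5 (p. 812); [MatarNekovar2019] Thm. 0.7 (p. 456),
§0.11 (p. 457); [McCallumLMS1991] §5 Lemma 5.1, Cor. 5.6; [Kolyvagin1990] Thm. A; [GrossLMS1991] §4 (4.1).
-/

set_option autoImplicit false
set_option linter.dupNamespace false

noncomputable section

open scoped Classical

namespace Summit.BirchSwinnertonDyer.BirchSwinnertonDyer.Theorems.WildKolyvaginUpperAtThreeOfGlobalDivisibility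

open WeierstrassCurve NumberField IsDedekindDomain Field
  Literature.NumberTheory.EllipticCurves
  Literature.NumberTheory.EllipticCurves.ModularForms
  Literature.NumberTheory.EllipticCurves.Rank1Residual
  Summit.BirchSwinnertonDyer.Rank1Residual
  Summit.BirchSwinnertonDyer.Rank1Residual.Additive
  Summit.BirchSwinnertonDyer.Rank1Residual.X11b
  Summit.BirchSwinnertonDyer.Rank1Residual.X11b.Three
  Summit.BirchSwinnertonDyer.BirchSwinnertonDyer.Theses.SemiOrdinaryEisensteinDescent
  Summit.BirchSwinnertonDyer.BirchSwinnertonDyer.Theorems.SchneiderFree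

/-- **Crux Ko `WildKolyvaginUpperAtThree` ⟸ J₃ʷ (displayed) + Matar–Nekovář Thm. 0.7/§0.11 (named) +
Kolyvagin (named).** With EXACTLY the crux's binders, the displayed hypothesis `hJ` asserts global
`3^{s′}`-divisibility of the derived Heegner points on the frame `(Dt, H.β, ι)` for all
`s′ ≤ ord₃ ∏_ℓ c_ℓ(E) + v₃(c(Dt))`; the receptacle `SchneiderFree.Exact.upper_of_globalDivisibility_of_surj`
turns it into the socket `Upper.IndexUpperBoundLeAt W 3 K P (v₃ c)` — the crux's conclusion. The tower binder
is idle (mod-`3` image suffices); `d_K ≠ −4` from `d_K` odd. CONDITIONAL on `hJ`, `hMN`, `hKo`; nothing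
asserted about any curve. [cite: Jetchev2008, Conj. 1.3 and Cor. 1.5 (p. 812)]
[cite: MatarNekovar2019, Thm. 0.7 (p. 456) and §0.11 (p. 457)] [cite: McCallumLMS1991, §5 Cor. 5.6 (p. 310)] -/
theorem wildKolyvaginUpperAtThree_of_globalDivisibility
    (hKo : ∀ (N : ℕ) [NeZero N] (W : WeierstrassCurve ℚ) (K : Type) [Field K] [NumberField K],
      kolyvagin N W K)
    (hMN : MatarNekovar2019.thm07_padicValNat_card_sha_primary_add_le_of_globalDivisibility_of_irreducible)
    (hJ : ∀ (W : WeierstrassCurve ℚ) [W.IsElliptic] [W.IsGloballyMinimal] (N : ℕ) [NeZero N] (K : Type)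
      [Field K] [NumberField K] (Dt : ModularParametrizationData W N)
      (H : HeegnerDatum N (NumberField.discr K)) (ι : K →+* ℂ) (P : (W.baseChange K).toAffine.Point),
      ClassO6 W 3 → W.HasSurjectiveModNGaloisRep 3 → W.analyticRank = 1 → W.conductorNorm ℤ = N →
      IsImaginaryQuadratic K → SatisfiesHeegnerHypothesis N K →
      (W.quadraticTwist (NumberField.discr K : ℚ)).entireLFunction 1 ≠ 0 →
      WeierstrassCurve.Affine.Point.map ι.toRatAlgHom P = heegnerPointComplex Dt H →
      ¬ IsOfFinAddOrder P → Odd (NumberField.discr K) → NumberField.discr K ≠ -3 →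
      AdditiveThree.TowerSurjThree W →
      ∀ (s' : ℕ), s' ≤ padicValNat 3 W.tamagawaProduct + padicValNat 3 Dt.c.natAbs →
        ∀ (n : ℕ) (d : KolyvaginHeegnerData Dt H.β ι n), Squarefree n →
          (∀ ℓ ∈ n.primeFactors, Zhang2014.IsKolyvaginPrime N W K 3 ℓ ∧
            s' ≤ Zhang2014.kolyvaginIndex W 3 ℓ) → Koly.PDiv d 3 s') :
    WildKolyvaginUpperAtThree := by
  intro W _ _ N _ K _ _ Dt H ι P hO6 hsurj hr hN hK hHH hLd hP hnt hodd h3 htower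
  have h4 : NumberField.discr K ≠ -4 := by
    intro h
    rw [h] at hodd
    exact (Int.not_odd_iff_even.mpr ⟨-2, by norm_num⟩) hodd
  have hglob := hJ W N K Dt H ι P hO6 hsurj hr hN hK hHH hLd hP hnt hodd h3 htower
  subst hN
  exact Exact.upper_of_globalDivisibility_of_surj hKo hMN W 3 (by decide) hsurj K hK h3 h4 hHH Dt H ι P hP
    hnt hglob

end Summit.BirchSwinnertonDyer.BirchSwinnertonDyer.Theorems.WildKolyvaginUpperAtThreeOfGlobalDivisibility

end
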